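import Summits.AtomisticToContinuum.FouriersLaw.Theorems.EmbeddedDrudeMourreDrudeDissolutionStubForceKernelsKernels
import HarnessLib

/-!
# The pair kernel of the first-order force is the bracket times the vertex; the force-kernel identities assembled
(helper `forceKernelIdentities` for stub `stub_forceKernels` (KΦ) of line `gram-pencil-harmonic-chaos`,
crux `EmbeddedDrudeMourre.DrudeDissolution`, item stmt-AtomisticToContinuum-12593; `--supports` file, closes nothing)

WHAT. For the quartic part `P₄ = Σ_j c_j :φφφφ:(f_j)` of the Wick presentation of
`Φ = (𝓛_{(a,b)} − 𝓛₀) j⁽²⁾₀ + b·𝓛₀ j⁽⁴⁾₀ = Ψ + b·𝓛₀j⁽⁴⁾`, `Ψ = ½ r₀[a(q₀³+q₁³) + b(r₋₁³ − r₁³)]`, the symmetrised pair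
kernel on the zero-momentum shell `Shell 2 2` satisfies EXACTLY
`Σ_j c_j wickKernel (f_j) 2 2 κ − A·i·[sin]·v_{a,b}/Πω = −(b/2)·i·Ω(κ)·𝒥(κ)`, `A = −3/4`,
`[sin] = sin c₀ + sin c₁ − sin a₀ − sin a₁`, `v_{a,b} = a + b·bondVertex = PinnedChainKinetic.vertex a b`,
`Πω = ω(c₀)ω(c₁)ω(a₀)ω(a₁)`, `Ω = sectorPhase ω₂` the pair resonance function and
`𝒥 = wickKernel(:p₀r₀r₀r₀:) + wickKernel(:p₁r₀r₀r₀:)` (`pair_kernel_identity`): the `Ψ`-part is exact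
(`pair_A`: `K(:r₀q₀³:) + K(:r₀q₁³:) = −(3/2)i[sin]/Πω`; `pair_B`: `K(:r₀r₋₁³:) − K(:r₀r₁³:) = −(3/2)i[sin]·B/Πω`, the bond
vertex being `Π(e^{±ik} − 1)` on the shell), and the momentum part `X = 𝓛₀j⁽⁴⁾` has pair kernel `−½iΩ𝒥` (`pair_X`:
creation slots of `𝓛₀` carry `+iω`, annihilation slots `−iω`). Since `𝒥` is continuous on the compact shell,
`‖Σ_j c_j K(f_j) − A i[sin] v/Πω‖ ≤ C|Ω|` (`pair_bound`), and with the presentation identity and the vanishing of the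
degree-2 chaos vector (sibling file `…Kernels`) this is the identities conjunct `forceKernelIdentities` of the stub
(numerically: `F_Φ/([sin]·v·Πω⁻¹) = −3/2` for the `Σ_{S₄}`-normalised kernel, i.e. `A = −3/4` for `wickKernel`).

HOW. Symmetrisation over `S₄` of the patterns `(g,h,h,h)` and `(g,g,h,h)` (`sum_perm_pattern_one/two`), the explicit
thermal waves of `…Waves`, and `field_simp; ring` in the unimodular variables `e^{ic₀}, e^{ic₁}, e^{ia₀}`
(`e^{ia₁} = e^{ic₀}e^{ic₁}e^{−ia₀}` on the shell) and the four band values; `pair_X` holds modulo the band relations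
`ω_i² = ω₂ + 2 − e_i − e_i⁻¹`, fed to `linear_combination` together with `I² = −1` times the `I`-free part so that the
residual identity is formal in `I`.
-/

noncomputable section

namespace Summit.AtomisticToContinuum.FouriersLaw.Theorems.DrudeDissolution.GramPencilHarmonicChaos

open MeasureTheory Filter Set Function Topology
open scoped InnerProductSpace ENNReal ComplexConjugate
open Literature.MathematicalPhysics.KineticTheory
open Literature.MathematicalPhysics.KineticTheory.HeatConduction
open Literature.MathematicalPhysics.KineticTheory.PhononBoltzmann
open HarmonicChaos ProbabilityTheory
open PinnedChainKinetic (𝕋 𝕋3 μ𝕋 μ𝕋3 k₄ sinT)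
open scoped Literature.MathematicalPhysics.KineticTheory.HeatConduction.PinnedChainKinetic

/-! ## §1 The pair kernel of the quartic part -/

/-- Symmetrisation of a product over the pattern `(g,h,h,h)`: `Σ_π = 6 Σ_{slot of g}`. [folklore] -/
theorem sum_perm_pattern_one {α M : Type*} [CommRing M] (F₀ F₁ F₂ F₃ : α → M) (g h : α) :
    ∑ π : Equiv.Perm (Fin 4), F₀ (![g, h, h, h] (π 0)) * F₁ (![g, h, h, h] (π 1)) *
      (F₂ (![g, h, h, h] (π 2)) * F₃ (![g, h, h, h] (π 3))) =
    6 * (F₀ g * F₁ h * (F₂ h * F₃ h) + F₀ h * F₁ g * (F₂ h * F₃ h) +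
      F₀ h * F₁ h * (F₂ g * F₃ h) + F₀ h * F₁ h * (F₂ h * F₃ g)) := by
  rw [sum_perm_fin_four (fun a b c d => F₀ (![g, h, h, h] a) * F₁ (![g, h, h, h] b) *
      (F₂ (![g, h, h, h] c) * F₃ (![g, h, h, h] d)))]
  simp only [Matrix.cons_val_zero, Matrix.cons_val_one, Matrix.cons_val]
  ring

/-- Symmetrisation of a product over the pattern `(g,g,h,h)`: `Σ_π = 4 Σ_{pair of slots of g}`. [folklore] -/
theorem sum_perm_pattern_two {α M : Type*} [CommRing M] (F₀ F₁ F₂ F₃ : α → M) (g h : α) :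
    ∑ π : Equiv.Perm (Fin 4), F₀ (![g, g, h, h] (π 0)) * F₁ (![g, g, h, h] (π 1)) *
      (F₂ (![g, g, h, h] (π 2)) * F₃ (![g, g, h, h] (π 3))) =
    4 * (F₀ g * F₁ g * (F₂ h * F₃ h) + F₀ g * F₁ h * (F₂ g * F₃ h) + F₀ g * F₁ h * (F₂ h * F₃ g) +
      F₀ h * F₁ g * (F₂ g * F₃ h) + F₀ h * F₁ g * (F₂ h * F₃ g) + F₀ h * F₁ h * (F₂ g * F₃ g)) := by
  rw [sum_perm_fin_four (fun a b c d => F₀ (![g, g, h, h] a) * F₁ (![g, g, h, h] b) *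
      (F₂ (![g, g, h, h] c) * F₃ (![g, g, h, h] d)))]
  simp only [Matrix.cons_val_zero, Matrix.cons_val_one, Matrix.cons_val]
  ring

section Pair

variable {ω₂ : ℝ} (κ : Shell 2 2)


/-- The pair kernel of a monomial of pattern `(g,h,h,h)`. [folklore] -/
theorem wickKernel_two_two_pattern_one (g h : TestFn) :
    wickKernel ω₂ 1 ![g, h, h, h] 2 2 κ = (1 / 2 : ℂ) * (6 *
      (conj (thermalWave ω₂ 1 g ((κ : SectorConfig 2 2).1 0)) * conj (thermalWave ω₂ 1 h ((κ : SectorConfig 2 2).1 1)) * (thermalWave ω₂ 1 h ((κ : SectorConfig 2 2).2 0) * thermalWave ω₂ 1 h ((κ : SectorConfig 2 2).2 1)) +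
        conj (thermalWave ω₂ 1 h ((κ : SectorConfig 2 2).1 0)) * conj (thermalWave ω₂ 1 g ((κ : SectorConfig 2 2).1 1)) * (thermalWave ω₂ 1 h ((κ : SectorConfig 2 2).2 0) * thermalWave ω₂ 1 h ((κ : SectorConfig 2 2).2 1)) +
        conj (thermalWave ω₂ 1 h ((κ : SectorConfig 2 2).1 0)) * conj (thermalWave ω₂ 1 h ((κ : SectorConfig 2 2).1 1)) * (thermalWave ω₂ 1 g ((κ : SectorConfig 2 2).2 0) * thermalWave ω₂ 1 h ((κ : SectorConfig 2 2).2 1)) +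
        conj (thermalWave ω₂ 1 h ((κ : SectorConfig 2 2).1 0)) * conj (thermalWave ω₂ 1 h ((κ : SectorConfig 2 2).1 1)) * (thermalWave ω₂ 1 h ((κ : SectorConfig 2 2).2 0) * thermalWave ω₂ 1 g ((κ : SectorConfig 2 2).2 1)))) := by
  rw [wickKernel_two_two]
  congr 1
  exact sum_perm_pattern_one (fun t => conj (thermalWave ω₂ 1 t ((κ : SectorConfig 2 2).1 0))) (fun t => conj (thermalWave ω₂ 1 t ((κ : SectorConfig 2 2).1 1)))
    (fun t => thermalWave ω₂ 1 t ((κ : SectorConfig 2 2).2 0)) (fun t => thermalWave ω₂ 1 t ((κ : SectorConfig 2 2).2 1)) g h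

/-- The pair kernel of a monomial of pattern `(g,g,h,h)`. [folklore] -/
theorem wickKernel_two_two_pattern_two (g h : TestFn) :
    wickKernel ω₂ 1 ![g, g, h, h] 2 2 κ = (1 / 2 : ℂ) * (4 *
      (conj (thermalWave ω₂ 1 g ((κ : SectorConfig 2 2).1 0)) * conj (thermalWave ω₂ 1 g ((κ : SectorConfig 2 2).1 1)) * (thermalWave ω₂ 1 h ((κ : SectorConfig 2 2).2 0) * thermalWave ω₂ 1 h ((κ : SectorConfig 2 2).2 1)) +
        conj (thermalWave ω₂ 1 g ((κ : SectorConfig 2 2).1 0)) * conj (thermalWave ω₂ 1 h ((κ : SectorConfig 2 2).1 1)) * (thermalWave ω₂ 1 g ((κ : SectorConfig 2 2).2 0) * thermalWave ω₂ 1 h ((κ : SectorConfig 2 2).2 1)) +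
        conj (thermalWave ω₂ 1 g ((κ : SectorConfig 2 2).1 0)) * conj (thermalWave ω₂ 1 h ((κ : SectorConfig 2 2).1 1)) * (thermalWave ω₂ 1 h ((κ : SectorConfig 2 2).2 0) * thermalWave ω₂ 1 g ((κ : SectorConfig 2 2).2 1)) +
        conj (thermalWave ω₂ 1 h ((κ : SectorConfig 2 2).1 0)) * conj (thermalWave ω₂ 1 g ((κ : SectorConfig 2 2).1 1)) * (thermalWave ω₂ 1 g ((κ : SectorConfig 2 2).2 0) * thermalWave ω₂ 1 h ((κ : SectorConfig 2 2).2 1)) +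
        conj (thermalWave ω₂ 1 h ((κ : SectorConfig 2 2).1 0)) * conj (thermalWave ω₂ 1 g ((κ : SectorConfig 2 2).1 1)) * (thermalWave ω₂ 1 h ((κ : SectorConfig 2 2).2 0) * thermalWave ω₂ 1 g ((κ : SectorConfig 2 2).2 1)) +
        conj (thermalWave ω₂ 1 h ((κ : SectorConfig 2 2).1 0)) * conj (thermalWave ω₂ 1 h ((κ : SectorConfig 2 2).1 1)) * (thermalWave ω₂ 1 g ((κ : SectorConfig 2 2).2 0) * thermalWave ω₂ 1 g ((κ : SectorConfig 2 2).2 1)))) := by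
  rw [wickKernel_two_two]
  congr 1
  exact sum_perm_pattern_two (fun t => conj (thermalWave ω₂ 1 t ((κ : SectorConfig 2 2).1 0))) (fun t => conj (thermalWave ω₂ 1 t ((κ : SectorConfig 2 2).1 1)))
    (fun t => thermalWave ω₂ 1 t ((κ : SectorConfig 2 2).2 0)) (fun t => thermalWave ω₂ 1 t ((κ : SectorConfig 2 2).2 1)) g h

/-- Collecting the four normalisation factors `√(1/2)` of a product of four thermal waves. [folklore] -/
theorem sqrt_half_four (a b c d : ℂ) :
    ((Real.sqrt (1 / 2) : ℝ) : ℂ) * a * (((Real.sqrt (1 / 2) : ℝ) : ℂ) * b) *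
      (((Real.sqrt (1 / 2) : ℝ) : ℂ) * c * (((Real.sqrt (1 / 2) : ℝ) : ℂ) * d)) = (1 / 4 : ℂ) * (a * b * (c * d)) := by
  have h2 : ((Real.sqrt (1 / 2) : ℝ) : ℂ) ^ 2 = 1 / 2 := by
    rw [← Complex.ofReal_pow, Real.sq_sqrt (by norm_num)]; push_cast; ring
  linear_combination (a * b * (c * d)) * (((Real.sqrt (1 / 2) : ℝ) : ℂ) ^ 2 + 1 / 2) * h2

/-- On the pair shell `e^{ia₁} = e^{ic₀} e^{ic₁} e^{−ia₀}`. [folklore] -/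
theorem expT_shell_two_two : (AddCircle.toCircle ((κ : SectorConfig 2 2).2 1) : ℂ) = (AddCircle.toCircle ((κ : SectorConfig 2 2).1 0) : ℂ) * (AddCircle.toCircle ((κ : SectorConfig 2 2).1 1) : ℂ) * ((AddCircle.toCircle ((κ : SectorConfig 2 2).2 0) : ℂ))⁻¹ := by
  rw [shell_two_two_snd κ, expT_k4]

/-- The bracket `i[sin] = i(sin c₀ + sin c₁ − sin a₀ − sin a₁)` in the unimodular variables. [folklore] -/
theorem I_mul_bracket :
    Complex.I * (((sinT ((κ : SectorConfig 2 2).1 0) : ℝ) : ℂ) + ((sinT ((κ : SectorConfig 2 2).1 1) : ℝ) : ℂ) - ((sinT ((κ : SectorConfig 2 2).2 0) : ℝ) : ℂ) - ((sinT ((κ : SectorConfig 2 2).2 1) : ℝ) : ℂ)) =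
      (((AddCircle.toCircle ((κ : SectorConfig 2 2).1 0) : ℂ) - ((AddCircle.toCircle ((κ : SectorConfig 2 2).1 0) : ℂ))⁻¹) + ((AddCircle.toCircle ((κ : SectorConfig 2 2).1 1) : ℂ) - ((AddCircle.toCircle ((κ : SectorConfig 2 2).1 1) : ℂ))⁻¹) - ((AddCircle.toCircle ((κ : SectorConfig 2 2).2 0) : ℂ) - ((AddCircle.toCircle ((κ : SectorConfig 2 2).2 0) : ℂ))⁻¹) -
        ((AddCircle.toCircle ((κ : SectorConfig 2 2).1 0) : ℂ) * (AddCircle.toCircle ((κ : SectorConfig 2 2).1 1) : ℂ) * ((AddCircle.toCircle ((κ : SectorConfig 2 2).2 0) : ℂ))⁻¹ - ((AddCircle.toCircle ((κ : SectorConfig 2 2).1 0) : ℂ) * (AddCircle.toCircle ((κ : SectorConfig 2 2).1 1) : ℂ) * ((AddCircle.toCircle ((κ : SectorConfig 2 2).2 0) : ℂ))⁻¹)⁻¹)) / 2 := by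
  have h1 := I_mul_sinT_coe_complex ((κ : SectorConfig 2 2).1 0)
  have h2 := I_mul_sinT_coe_complex ((κ : SectorConfig 2 2).1 1)
  have h3 := I_mul_sinT_coe_complex ((κ : SectorConfig 2 2).2 0)
  have h4 := I_mul_sinT_coe_complex ((κ : SectorConfig 2 2).2 1)
  rw [expT_shell_two_two κ] at h4
  linear_combination h1 + h2 - h3 - h4

/-- **(β), the `a`-part**: `K(:r₀q₀q₀q₀:) + K(:r₀q₁q₁q₁:) = −(3/2)·i[sin]/Πω` exactly on the shell.
[cite: AokiLukkarinenSpohn2006, §3 eqs. (3.15)–(3.17)] -/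
theorem pair_A (hω : 0 < ω₂) :
    wickKernel ω₂ 1 ![((Finsupp.single 1 1, 0) + (Finsupp.single 0 (-1), 0)), (Finsupp.single 0 1, 0), (Finsupp.single 0 1, 0), (Finsupp.single 0 1, 0)] 2 2 κ + wickKernel ω₂ 1 ![((Finsupp.single 1 1, 0) + (Finsupp.single 0 (-1), 0)), (Finsupp.single 1 1, 0), (Finsupp.single 1 1, 0), (Finsupp.single 1 1, 0)] 2 2 κ =
      2 * ((-3 / 4 : ℝ) : ℂ) * Complex.I *
        (((sinT ((κ : SectorConfig 2 2).1 0) : ℝ) : ℂ) + ((sinT ((κ : SectorConfig 2 2).1 1) : ℝ) : ℂ) - ((sinT ((κ : SectorConfig 2 2).2 0) : ℝ) : ℂ) - ((sinT ((κ : SectorConfig 2 2).2 1) : ℝ) : ℂ)) /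
        (((PinnedChainKinetic.dispersion ω₂ ((κ : SectorConfig 2 2).1 0) : ℝ) : ℂ) * ((PinnedChainKinetic.dispersion ω₂ ((κ : SectorConfig 2 2).1 1) : ℝ) : ℂ) *
          ((PinnedChainKinetic.dispersion ω₂ ((κ : SectorConfig 2 2).2 0) : ℝ) : ℂ) * ((PinnedChainKinetic.dispersion ω₂ ((κ : SectorConfig 2 2).2 1) : ℝ) : ℂ)) := by
  have hE1 := expT_ne_zero ((κ : SectorConfig 2 2).1 0)
  have hE2 := expT_ne_zero ((κ : SectorConfig 2 2).1 1)
  have hE3 := expT_ne_zero ((κ : SectorConfig 2 2).2 0)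
  have hω1 : ((PinnedChainKinetic.dispersion ω₂ ((κ : SectorConfig 2 2).1 0) : ℝ) : ℂ) ≠ 0 :=
    Complex.ofReal_ne_zero.2 (PinnedChainKinetic.dispersion_ne_zero hω _)
  have hω2 : ((PinnedChainKinetic.dispersion ω₂ ((κ : SectorConfig 2 2).1 1) : ℝ) : ℂ) ≠ 0 :=
    Complex.ofReal_ne_zero.2 (PinnedChainKinetic.dispersion_ne_zero hω _)
  have hω3 : ((PinnedChainKinetic.dispersion ω₂ ((κ : SectorConfig 2 2).2 0) : ℝ) : ℂ) ≠ 0 :=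
    Complex.ofReal_ne_zero.2 (PinnedChainKinetic.dispersion_ne_zero hω _)
  have hω4 : ((PinnedChainKinetic.dispersion ω₂ ((κ : SectorConfig 2 2).2 1) : ℝ) : ℂ) ≠ 0 :=
    Complex.ofReal_ne_zero.2 (PinnedChainKinetic.dispersion_ne_zero hω _)
  rw [show ∀ X Y : ℂ, 2 * (((-3 / 4 : ℝ)) : ℂ) * Complex.I * X / Y = 2 * (((-3 / 4 : ℝ)) : ℂ) * (Complex.I * X) / Y
    from fun X Y => by ring, I_mul_bracket κ]
  rw [wickKernel_two_two_pattern_one, wickKernel_two_two_pattern_one]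
  simp only [cw_R0, cw_Q0, cw_Q1]
  simp only [w_R0, w_Q0, w_Q1, expT_shell_two_two κ, sqrt_half_four]
  push_cast
  field_simp
  ring


/-- **(β), the bond part**: `K(:r₀r₋₁r₋₁r₋₁:) − K(:r₀r₁r₁r₁:) = −(3/2)·i[sin]·B/Πω` exactly on the shell, `B` the bond
vertex (`Π(e^{±ik} − 1) = bondVertex` on the shell). [cite: AokiLukkarinenSpohn2006, §3 eqs. (3.15)–(3.17)] -/
theorem pair_B (hω : 0 < ω₂) :
    wickKernel ω₂ 1 ![((Finsupp.single 1 1, 0) + (Finsupp.single 0 (-1), 0)), ((Finsupp.single 0 1, 0) + (Finsupp.single (-1) (-1), 0)), ((Finsupp.single 0 1, 0) + (Finsupp.single (-1) (-1), 0)), ((Finsupp.single 0 1, 0) + (Finsupp.single (-1) (-1), 0))] 2 2 κ - wickKernel ω₂ 1 ![((Finsupp.single 1 1, 0) + (Finsupp.single 0 (-1), 0)), ((Finsupp.single 2 1, 0) + (Finsupp.single 1 (-1), 0)), ((Finsupp.single 2 1, 0) + (Finsupp.single 1 (-1), 0)), ((Finsupp.single 2 1, 0) + (Finsupp.single 1 (-1),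 0))] 2 2 κ =
      2 * ((-3 / 4 : ℝ) : ℂ) * Complex.I *
        (((sinT ((κ : SectorConfig 2 2).1 0) : ℝ) : ℂ) + ((sinT ((κ : SectorConfig 2 2).1 1) : ℝ) : ℂ) - ((sinT ((κ : SectorConfig 2 2).2 0) : ℝ) : ℂ) - ((sinT ((κ : SectorConfig 2 2).2 1) : ℝ) : ℂ)) *
        ((PinnedChainKinetic.bondVertex (((κ : SectorConfig 2 2).1 0), ((κ : SectorConfig 2 2).1 1), ((κ : SectorConfig 2 2).2 0)) : ℝ) : ℂ) /
        (((PinnedChainKinetic.dispersion ω₂ ((κ : SectorConfig 2 2).1 0) : ℝ) : ℂ) * ((PinnedChainKinetic.dispersion ω₂ ((κ : SectorConfig 2 2).1 1) : ℝ) : ℂ) *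
          ((PinnedChainKinetic.dispersion ω₂ ((κ : SectorConfig 2 2).2 0) : ℝ) : ℂ) * ((PinnedChainKinetic.dispersion ω₂ ((κ : SectorConfig 2 2).2 1) : ℝ) : ℂ)) := by
  have hE1 := expT_ne_zero ((κ : SectorConfig 2 2).1 0)
  have hE2 := expT_ne_zero ((κ : SectorConfig 2 2).1 1)
  have hE3 := expT_ne_zero ((κ : SectorConfig 2 2).2 0)
  have hω1 : ((PinnedChainKinetic.dispersion ω₂ ((κ : SectorConfig 2 2).1 0) : ℝ) : ℂ) ≠ 0 :=
    Complex.ofReal_ne_zero.2 (PinnedChainKinetic.dispersion_ne_zero hω _)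
  have hω2 : ((PinnedChainKinetic.dispersion ω₂ ((κ : SectorConfig 2 2).1 1) : ℝ) : ℂ) ≠ 0 :=
    Complex.ofReal_ne_zero.2 (PinnedChainKinetic.dispersion_ne_zero hω _)
  have hω3 : ((PinnedChainKinetic.dispersion ω₂ ((κ : SectorConfig 2 2).2 0) : ℝ) : ℂ) ≠ 0 :=
    Complex.ofReal_ne_zero.2 (PinnedChainKinetic.dispersion_ne_zero hω _)
  have hω4 : ((PinnedChainKinetic.dispersion ω₂ ((κ : SectorConfig 2 2).2 1) : ℝ) : ℂ) ≠ 0 :=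
    Complex.ofReal_ne_zero.2 (PinnedChainKinetic.dispersion_ne_zero hω _)
  rw [show ∀ X Y Z : ℂ, 2 * (((-3 / 4 : ℝ)) : ℂ) * Complex.I * X * Z / Y =
    2 * (((-3 / 4 : ℝ)) : ℂ) * (Complex.I * X) * Z / Y from fun X Y Z => by ring, I_mul_bracket κ]
  simp only [PinnedChainKinetic.bondVertex, k₄]
  push_cast
  simp only [cosT_coe_complex, expT_add, expT_sub]
  rw [wickKernel_two_two_pattern_one, wickKernel_two_two_pattern_one]
  simp only [cw_R0, cw_R1, cw_Rm]
  simp only [w_R0, w_R1, w_Rm, expT_shell_two_two κ, sqrt_half_four]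
  field_simp
  ring

/-- **(β), the momentum part**: the pair kernel of `X = (3/2)(p₀²−p₁²)r₀² + (ω₂/2)r₀³(q₀+q₁) − ½r₀³(r₁−r₋₁)
= 𝓛₀ j⁽⁴⁾` is `−½·i·Ω·𝒥`, `𝒥 = K(:p₀r₀r₀r₀:) + K(:p₁r₀r₀r₀:)` (the creation slots of `𝓛₀` carry `+iω`, the
annihilation slots `−iω`): an identity modulo the four band relations `ω_i² = ω₂ + 2 − 2cos k_i`. [folklore] -/
theorem pair_X (hω : 0 < ω₂) :
    (3 / 2 : ℂ) * (wickKernel ω₂ 1 ![(0, Finsupp.single 0 1), (0, Finsupp.single 0 1), ((Finsupp.single 1 1, 0) + (Finsupp.single 0 (-1), 0)), ((Finsupp.single 1 1, 0) + (Finsupp.single 0 (-1), 0))] 2 2 κ - wickKernel ω₂ 1 ![(0, Finsupp.single 1 1), (0, Finsupp.single 1 1), ((Finsupp.single 1 1, 0) + (Finsupp.single 0 (-1), 0)), ((Finsupp.single 1 1, 0) + (Finsupp.single 0 (-1), 0))] 2 2 κ) +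
      ((ω₂ : ℂ) / 2) * (wickKernel ω₂ 1 ![(Finsupp.single 0 1, 0), ((Finsupp.single 1 1, 0) + (Finsupp.single 0 (-1), 0)), ((Finsupp.single 1 1, 0) + (Finsupp.single 0 (-1), 0)), ((Finsupp.single 1 1, 0) + (Finsupp.single 0 (-1), 0))] 2 2 κ + wickKernel ω₂ 1 ![(Finsupp.single 1 1, 0), ((Finsupp.single 1 1, 0) + (Finsupp.single 0 (-1), 0)), ((Finsupp.single 1 1, 0) + (Finsupp.single 0 (-1), 0)), ((Finsupp.single 1 1, 0) + (Finsupp.single 0 (-1), 0))] 2 2 κ) -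
      (1 / 2 : ℂ) * (wickKernel ω₂ 1 ![((Finsupp.single 2 1, 0) + (Finsupp.single 1 (-1), 0)), ((Finsupp.single 1 1, 0) + (Finsupp.single 0 (-1), 0)), ((Finsupp.single 1 1, 0) + (Finsupp.single 0 (-1), 0)), ((Finsupp.single 1 1, 0) + (Finsupp.single 0 (-1), 0))] 2 2 κ - wickKernel ω₂ 1 ![((Finsupp.single 0 1, 0) + (Finsupp.single (-1) (-1), 0)), ((Finsupp.single 1 1, 0) + (Finsupp.single 0 (-1), 0)), ((Finsupp.single 1 1, 0) + (Finsupp.single 0 (-1), 0)), ((Finsupp.single 1 1, 0) + (Finsupp.single 0 (-1), 0))] 2 2 κ) =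
    -(1 / 2 : ℂ) * Complex.I * ((sectorPhase ω₂ κ : ℝ) : ℂ) *
      (wickKernel ω₂ 1 ![(0, Finsupp.single 0 1), ((Finsupp.single 1 1, 0) + (Finsupp.single 0 (-1), 0)), ((Finsupp.single 1 1, 0) + (Finsupp.single 0 (-1), 0)), ((Finsupp.single 1 1, 0) + (Finsupp.single 0 (-1), 0))] 2 2 κ + wickKernel ω₂ 1 ![(0, Finsupp.single 1 1), ((Finsupp.single 1 1, 0) + (Finsupp.single 0 (-1), 0)), ((Finsupp.single 1 1, 0) + (Finsupp.single 0 (-1), 0)), ((Finsupp.single 1 1, 0) + (Finsupp.single 0 (-1), 0))] 2 2 κ) := by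
  have hE1 := expT_ne_zero ((κ : SectorConfig 2 2).1 0)
  have hE2 := expT_ne_zero ((κ : SectorConfig 2 2).1 1)
  have hE3 := expT_ne_zero ((κ : SectorConfig 2 2).2 0)
  have hω1 : ((PinnedChainKinetic.dispersion ω₂ ((κ : SectorConfig 2 2).1 0) : ℝ) : ℂ) ≠ 0 :=
    Complex.ofReal_ne_zero.2 (PinnedChainKinetic.dispersion_ne_zero hω _)
  have hω2 : ((PinnedChainKinetic.dispersion ω₂ ((κ : SectorConfig 2 2).1 1) : ℝ) : ℂ) ≠ 0 :=
    Complex.ofReal_ne_zero.2 (PinnedChainKinetic.dispersion_ne_zero hω _)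
  have hω3 : ((PinnedChainKinetic.dispersion ω₂ ((κ : SectorConfig 2 2).2 0) : ℝ) : ℂ) ≠ 0 :=
    Complex.ofReal_ne_zero.2 (PinnedChainKinetic.dispersion_ne_zero hω _)
  have hω4 : ((PinnedChainKinetic.dispersion ω₂ ((κ : SectorConfig 2 2).2 1) : ℝ) : ℂ) ≠ 0 :=
    Complex.ofReal_ne_zero.2 (PinnedChainKinetic.dispersion_ne_zero hω _)
  have r1 := dispersion_sq_coe_complex hω.le ((κ : SectorConfig 2 2).1 0)
  have r2 := dispersion_sq_coe_complex hω.le ((κ : SectorConfig 2 2).1 1)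
  have r3 := dispersion_sq_coe_complex hω.le ((κ : SectorConfig 2 2).2 0)
  have r4 := dispersion_sq_coe_complex hω.le ((κ : SectorConfig 2 2).2 1)
  rw [expT_shell_two_two κ] at r4
  have hI : Complex.I ^ 2 = -1 := Complex.I_sq
  rw [sectorPhase_two_two]
  push_cast
  -- `β·(I² + 1)` with `β` the `I`-free part of the left side makes the identity FORMAL in `I`;
  -- the band relations enter with the coefficients `−I²·c_s`, `c_s = −(3/8)(1+ε_s)Π_{j≠s}(ε_j − 1)/Πω`.
  linear_combination (norm := skip)
    (((ω₂ : ℂ) / 2) * (wickKernel ω₂ 1 ![(Finsupp.single 0 1, 0), ((Finsupp.single 1 1, 0) + (Finsupp.single 0 (-1), 0)), ((Finsupp.single 1 1, 0) + (Finsupp.single 0 (-1), 0)), ((Finsupp.single 1 1, 0) + (Finsupp.single 0 (-1), 0))] 2 2 κ + wickKernel ω₂ 1 ![(Finsupp.single 1 1, 0), ((Finsupp.single 1 1, 0) + (Finsupp.single 0 (-1), 0)), ((Finsupp.single 1 1, 0) + (Finsupp.single 0 (-1), 0)), ((Finsupp.single 1 1, 0) + (Finsupp.single 0 (-1), 0))]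 2 2 κ) -
      (1 / 2 : ℂ) * (wickKernel ω₂ 1 ![((Finsupp.single 2 1, 0) + (Finsupp.single 1 (-1), 0)), ((Finsupp.single 1 1, 0) + (Finsupp.single 0 (-1), 0)), ((Finsupp.single 1 1, 0) + (Finsupp.single 0 (-1), 0)), ((Finsupp.single 1 1, 0) + (Finsupp.single 0 (-1), 0))] 2 2 κ - wickKernel ω₂ 1 ![((Finsupp.single 0 1, 0) + (Finsupp.single (-1) (-1), 0)), ((Finsupp.single 1 1, 0) + (Finsupp.single 0 (-1), 0)), ((Finsupp.single 1 1, 0) + (Finsupp.single 0 (-1), 0)), ((Finsupp.single 1 1, 0) + (Finsupp.single 0 (-1), 0))] 2 2 κ)) * hI +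
    (Complex.I ^ 2 * (3 / 8 : ℂ) * ((((AddCircle.toCircle ((κ : SectorConfig 2 2).1 1) : ℂ))⁻¹ - 1) * ((AddCircle.toCircle ((κ : SectorConfig 2 2).2 0) : ℂ) - 1) * ((AddCircle.toCircle ((κ : SectorConfig 2 2).1 0) : ℂ) * (AddCircle.toCircle ((κ : SectorConfig 2 2).1 1) : ℂ) * ((AddCircle.toCircle ((κ : SectorConfig 2 2).2 0) : ℂ))⁻¹ - 1)) *
        (1 + ((AddCircle.toCircle ((κ : SectorConfig 2 2).1 0) : ℂ))⁻¹) /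
      (((PinnedChainKinetic.dispersion ω₂ ((κ : SectorConfig 2 2).1 0) : ℝ) : ℂ) * ((PinnedChainKinetic.dispersion ω₂ ((κ : SectorConfig 2 2).1 1) : ℝ) : ℂ) *
        ((PinnedChainKinetic.dispersion ω₂ ((κ : SectorConfig 2 2).2 0) : ℝ) : ℂ) * ((PinnedChainKinetic.dispersion ω₂ ((κ : SectorConfig 2 2).2 1) : ℝ) : ℂ))) * r1 +
    (Complex.I ^ 2 * (3 / 8 : ℂ) * ((((AddCircle.toCircle ((κ : SectorConfig 2 2).1 0) : ℂ))⁻¹ - 1) * ((AddCircle.toCircle ((κ : SectorConfig 2 2).2 0) : ℂ) - 1) * ((AddCircle.toCircle ((κ : SectorConfig 2 2).1 0) : ℂ) * (AddCircle.toCircle ((κ : SectorConfig 2 2).1 1) : ℂ) * ((AddCircle.toCircle ((κ : SectorConfig 2 2).2 0) : ℂ))⁻¹ - 1)) *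
        (1 + ((AddCircle.toCircle ((κ : SectorConfig 2 2).1 1) : ℂ))⁻¹) /
      (((PinnedChainKinetic.dispersion ω₂ ((κ : SectorConfig 2 2).1 0) : ℝ) : ℂ) * ((PinnedChainKinetic.dispersion ω₂ ((κ : SectorConfig 2 2).1 1) : ℝ) : ℂ) *
        ((PinnedChainKinetic.dispersion ω₂ ((κ : SectorConfig 2 2).2 0) : ℝ) : ℂ) * ((PinnedChainKinetic.dispersion ω₂ ((κ : SectorConfig 2 2).2 1) : ℝ) : ℂ))) * r2 +
    (Complex.I ^ 2 * (3 / 8 : ℂ) * ((((AddCircle.toCircle ((κ : SectorConfig 2 2).1 0) : ℂ))⁻¹ - 1) * (((AddCircle.toCircle ((κ : SectorConfig 2 2).1 1) : ℂ))⁻¹ - 1) * ((AddCircle.toCircle ((κ : SectorConfig 2 2).1 0) : ℂ) * (AddCircle.toCircle ((κ : SectorConfig 2 2).1 1) : ℂ) * ((AddCircle.toCircle ((κ : SectorConfig 2 2).2 0) : ℂ))⁻¹ - 1)) *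
        (1 + (AddCircle.toCircle ((κ : SectorConfig 2 2).2 0) : ℂ)) /
      (((PinnedChainKinetic.dispersion ω₂ ((κ : SectorConfig 2 2).1 0) : ℝ) : ℂ) * ((PinnedChainKinetic.dispersion ω₂ ((κ : SectorConfig 2 2).1 1) : ℝ) : ℂ) *
        ((PinnedChainKinetic.dispersion ω₂ ((κ : SectorConfig 2 2).2 0) : ℝ) : ℂ) * ((PinnedChainKinetic.dispersion ω₂ ((κ : SectorConfig 2 2).2 1) : ℝ) : ℂ))) * r3 +
    (Complex.I ^ 2 * (3 / 8 : ℂ) * ((((AddCircle.toCircle ((κ : SectorConfig 2 2).1 0) : ℂ))⁻¹ - 1) * (((AddCircle.toCircle ((κ : SectorConfig 2 2).1 1) : ℂ))⁻¹ - 1) * ((AddCircle.toCircle ((κ : SectorConfig 2 2).2 0) : ℂ) - 1)) *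
        (1 + (AddCircle.toCircle ((κ : SectorConfig 2 2).1 0) : ℂ) * (AddCircle.toCircle ((κ : SectorConfig 2 2).1 1) : ℂ) * ((AddCircle.toCircle ((κ : SectorConfig 2 2).2 0) : ℂ))⁻¹) /
      (((PinnedChainKinetic.dispersion ω₂ ((κ : SectorConfig 2 2).1 0) : ℝ) : ℂ) * ((PinnedChainKinetic.dispersion ω₂ ((κ : SectorConfig 2 2).1 1) : ℝ) : ℂ) *
        ((PinnedChainKinetic.dispersion ω₂ ((κ : SectorConfig 2 2).2 0) : ℝ) : ℂ) * ((PinnedChainKinetic.dispersion ω₂ ((κ : SectorConfig 2 2).2 1) : ℝ) : ℂ))) * r4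
  simp only [wickKernel_two_two_pattern_one, wickKernel_two_two_pattern_two]
  simp only [cw_P0, cw_P1, cw_R0, cw_Q0, cw_Q1, cw_R1, cw_Rm]
  simp only [w_P0, w_P1, w_R0, w_Q0, w_Q1, w_R1, w_Rm, expT_shell_two_two κ, sqrt_half_four]
  field_simp
  ring


/-- **(β) THE PAIR KERNEL IS THE BRACKET TIMES THE VERTEX**, up to `Ω·𝒥`:
`Σ_j c_j K(f_j)(κ) − A·i·[sin]·v_{a,b}/Πω = −(b/2)·i·Ω(κ)·𝒥(κ)` with `A = −3/4`.
[cite: AokiLukkarinenSpohn2006, §3 eqs. (3.15)–(3.17)] -/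
theorem pair_kernel_identity (hω : 0 < ω₂) (a b : ℝ) :
    (∑ j : Fin 10, ((![a / 2, a / 2, b / 2, -(b / 2), 3 * b / 2, -(3 * b / 2), b * ω₂ / 2, b * ω₂ / 2, -(b / 2), b / 2] : Fin 10 → ℝ) j : ℂ) * wickKernel ω₂ 1 ((![![((Finsupp.single 1 1, 0) + (Finsupp.single 0 (-1), 0)), (Finsupp.single 0 1, 0), (Finsupp.single 0 1, 0), (Finsupp.single 0 1, 0)], ![((Finsupp.single 1 1, 0) + (Finsupp.single 0 (-1), 0)), (Finsupp.single 1 1, 0), (Finsupp.single 1 1, 0), (Finsupp.single 1 1, 0)], ![((Finsupp.single 1 1, 0) + (Finsupp.single 0 (-1), 0)), ((Finsupp.single 0 1, 0) + (Finsupp.single (-1) (-1), 0)), ((Finsupp.single 0 1, 0) + (Finsupp.single (-1) (-1), 0)), ((Finsupp.single 0 1, 0) + (Finsupp.single (-1) (-1), 0))], ![((Finsupp.single 1 1, 0) + (Finsupp.single 0 (-1), 0)), ((Finsupp.single 2 1, 0) + (Finsupp.single 1 (-1), 0)), ((Finsupp.single 2 1, 0) + (Finsupp.single 1 (-1), 0)),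 ((Finsupp.single 2 1, 0) + (Finsupp.single 1 (-1), 0))], ![(0, Finsupp.single 0 1), (0, Finsupp.single 0 1), ((Finsupp.single 1 1, 0) + (Finsupp.single 0 (-1), 0)), ((Finsupp.single 1 1, 0) + (Finsupp.single 0 (-1), 0))], ![(0, Finsupp.single 1 1), (0, Finsupp.single 1 1), ((Finsupp.single 1 1, 0) + (Finsupp.single 0 (-1), 0)), ((Finsupp.single 1 1, 0) + (Finsupp.single 0 (-1), 0))], ![(Finsupp.single 0 1, 0), ((Finsupp.single 1 1, 0) + (Finsupp.single 0 (-1), 0)), ((Finsupp.single 1 1, 0) + (Finsupp.single 0 (-1), 0)), ((Finsupp.single 1 1, 0) + (Finsupp.single 0 (-1), 0))], ![(Finsupp.single 1 1, 0), ((Finsupp.single 1 1, 0) + (Finsupp.single 0 (-1), 0)), ((Finsupp.single 1 1, 0) + (Finsupp.single 0 (-1), 0)), ((Finsupp.single 1 1, 0) + (Finsupp.single 0 (-1), 0))], ![((Finsupp.single 2 1, 0) + (Finsupp.single 1 (-1), 0)), ((Finsupp.single 1 1, 0) + (Finsupp.single 0 (-1), 0)), ((Finsupp.single 1 1, 0)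 + (Finsupp.single 0 (-1), 0)), ((Finsupp.single 1 1, 0) + (Finsupp.single 0 (-1), 0))], ![((Finsupp.single 0 1, 0) + (Finsupp.single (-1) (-1), 0)), ((Finsupp.single 1 1, 0) + (Finsupp.single 0 (-1), 0)), ((Finsupp.single 1 1, 0) + (Finsupp.single 0 (-1), 0)), ((Finsupp.single 1 1, 0) + (Finsupp.single 0 (-1), 0))]] : Fin 10 → Fin 4 → TestFn) j) 2 2 κ) -
        ((-3 / 4 : ℝ) : ℂ) * Complex.I *
          ((sinT ((κ : SectorConfig 2 2).1 0) + sinT ((κ : SectorConfig 2 2).1 1) - sinT ((κ : SectorConfig 2 2).2 0) - sinT ((κ : SectorConfig 2 2).2 1) : ℝ) : ℂ) *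
          (PinnedChainKinetic.vertex a b (((κ : SectorConfig 2 2).1 0), ((κ : SectorConfig 2 2).1 1), ((κ : SectorConfig 2 2).2 0)) : ℂ) /
          ((PinnedChainKinetic.dispersion ω₂ ((κ : SectorConfig 2 2).1 0) * PinnedChainKinetic.dispersion ω₂ ((κ : SectorConfig 2 2).1 1) *
            PinnedChainKinetic.dispersion ω₂ ((κ : SectorConfig 2 2).2 0) * PinnedChainKinetic.dispersion ω₂ ((κ : SectorConfig 2 2).2 1) : ℝ) : ℂ) =
      ((-(b / 2) : ℝ) : ℂ) * (Complex.I * ((sectorPhase ω₂ κ : ℝ) : ℂ) *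
        (wickKernel ω₂ 1 ![(0, Finsupp.single 0 1), ((Finsupp.single 1 1, 0) + (Finsupp.single 0 (-1), 0)), ((Finsupp.single 1 1, 0) + (Finsupp.single 0 (-1), 0)), ((Finsupp.single 1 1, 0) + (Finsupp.single 0 (-1), 0))] 2 2 κ + wickKernel ω₂ 1 ![(0, Finsupp.single 1 1), ((Finsupp.single 1 1, 0) + (Finsupp.single 0 (-1), 0)), ((Finsupp.single 1 1, 0) + (Finsupp.single 0 (-1), 0)), ((Finsupp.single 1 1, 0) + (Finsupp.single 0 (-1), 0))] 2 2 κ)) := by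
  have hA := pair_A κ hω
  have hB := pair_B κ hω
  have hX := pair_X κ hω
  simp only [Fin.sum_univ_succ, Fin.sum_univ_zero, Matrix.cons_val_zero, Matrix.cons_val_succ,
    PinnedChainKinetic.vertex]
  push_cast at hA hB hX ⊢
  linear_combination ((a : ℂ) / 2) * hA + ((b : ℂ) / 2) * hB + (b : ℂ) * hX

end Pair

/-- **(β), the bound**: `‖Σ_j c_j K(f_j)(κ) − A·i·[sin]·v/Πω‖ ≤ C·|Ω(κ)|` with `C = |b|/2 · sup‖𝒥‖`
(`𝒥` is continuous on the compact pair shell). [folklore] -/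
theorem pair_bound {ω₂ : ℝ} (hω : 0 < ω₂) (a b : ℝ) :
    ∃ C : ℝ, ∀ κ : Shell 2 2,
      ‖(∑ j : Fin 10, ((![a / 2, a / 2, b / 2, -(b / 2), 3 * b / 2, -(3 * b / 2), b * ω₂ / 2, b * ω₂ / 2, -(b / 2), b / 2] : Fin 10 → ℝ) j : ℂ) * wickKernel ω₂ 1 ((![![((Finsupp.single 1 1, 0) + (Finsupp.single 0 (-1), 0)), (Finsupp.single 0 1, 0), (Finsupp.single 0 1, 0), (Finsupp.single 0 1, 0)], ![((Finsupp.single 1 1, 0) + (Finsupp.single 0 (-1), 0)), (Finsupp.single 1 1, 0), (Finsupp.single 1 1, 0), (Finsupp.single 1 1, 0)], ![((Finsupp.single 1 1, 0) + (Finsupp.single 0 (-1), 0)), ((Finsupp.single 0 1, 0) + (Finsupp.single (-1) (-1), 0)), ((Finsupp.single 0 1, 0) + (Finsupp.single (-1) (-1), 0)), ((Finsupp.single 0 1, 0) + (Finsupp.single (-1) (-1), 0))], ![((Finsupp.single 1 1, 0) + (Finsupp.single 0 (-1), 0)), ((Finsupp.single 2 1, 0) + (Finsupp.single 1 (-1),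 0)), ((Finsupp.single 2 1, 0) + (Finsupp.single 1 (-1), 0)), ((Finsupp.single 2 1, 0) + (Finsupp.single 1 (-1), 0))], ![(0, Finsupp.single 0 1), (0, Finsupp.single 0 1), ((Finsupp.single 1 1, 0) + (Finsupp.single 0 (-1), 0)), ((Finsupp.single 1 1, 0) + (Finsupp.single 0 (-1), 0))], ![(0, Finsupp.single 1 1), (0, Finsupp.single 1 1), ((Finsupp.single 1 1, 0) + (Finsupp.single 0 (-1), 0)), ((Finsupp.single 1 1, 0) + (Finsupp.single 0 (-1), 0))], ![(Finsupp.single 0 1, 0), ((Finsupp.single 1 1, 0) + (Finsupp.single 0 (-1), 0)), ((Finsupp.single 1 1, 0) + (Finsupp.single 0 (-1), 0)), ((Finsupp.single 1 1, 0) + (Finsupp.single 0 (-1), 0))], ![(Finsupp.single 1 1, 0), ((Finsupp.single 1 1, 0) + (Finsupp.single 0 (-1), 0)), ((Finsupp.single 1 1, 0) + (Finsupp.single 0 (-1), 0)), ((Finsupp.single 1 1, 0) + (Finsupp.single 0 (-1), 0))], ![((Finsupp.single 2 1, 0) + (Finsupp.single 1 (-1), 0)), ((Finsupp.single 1 1,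 0) + (Finsupp.single 0 (-1), 0)), ((Finsupp.single 1 1, 0) + (Finsupp.single 0 (-1), 0)), ((Finsupp.single 1 1, 0) + (Finsupp.single 0 (-1), 0))], ![((Finsupp.single 0 1, 0) + (Finsupp.single (-1) (-1), 0)), ((Finsupp.single 1 1, 0) + (Finsupp.single 0 (-1), 0)), ((Finsupp.single 1 1, 0) + (Finsupp.single 0 (-1), 0)), ((Finsupp.single 1 1, 0) + (Finsupp.single 0 (-1), 0))]] : Fin 10 → Fin 4 → TestFn) j) 2 2 κ) -
          ((-3 / 4 : ℝ) : ℂ) * Complex.I *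
            ((sinT ((κ : SectorConfig 2 2).1 0) + sinT ((κ : SectorConfig 2 2).1 1) -
              sinT ((κ : SectorConfig 2 2).2 0) - sinT ((κ : SectorConfig 2 2).2 1) : ℝ) : ℂ) *
            (PinnedChainKinetic.vertex a b
              ((κ : SectorConfig 2 2).1 0, (κ : SectorConfig 2 2).1 1, (κ : SectorConfig 2 2).2 0) : ℂ) /
            ((PinnedChainKinetic.dispersion ω₂ ((κ : SectorConfig 2 2).1 0) *
              PinnedChainKinetic.dispersion ω₂ ((κ : SectorConfig 2 2).1 1) *
              PinnedChainKinetic.dispersion ω₂ ((κ : SectorConfig 2 2).2 0) *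
              PinnedChainKinetic.dispersion ω₂ ((κ : SectorConfig 2 2).2 1) : ℝ) : ℂ)‖ ≤
        C * |sectorPhase ω₂ κ| := by
  set J : Shell 2 2 → ℂ := fun κ =>
    wickKernel ω₂ 1 ![(0, Finsupp.single 0 1), ((Finsupp.single 1 1, 0) + (Finsupp.single 0 (-1), 0)), ((Finsupp.single 1 1, 0) + (Finsupp.single 0 (-1), 0)), ((Finsupp.single 1 1, 0) + (Finsupp.single 0 (-1), 0))] 2 2 κ + wickKernel ω₂ 1 ![(0, Finsupp.single 1 1), ((Finsupp.single 1 1, 0) + (Finsupp.single 0 (-1), 0)), ((Finsupp.single 1 1, 0) + (Finsupp.single 0 (-1), 0)), ((Finsupp.single 1 1, 0) + (Finsupp.single 0 (-1), 0))] 2 2 κ with hJ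
  have hc : Continuous J := (continuous_wickKernel hω 1 _ 2 2).add (continuous_wickKernel hω 1 _ 2 2)
  obtain ⟨M, hM⟩ := isCompact_univ.exists_bound_of_continuousOn hc.continuousOn
  refine ⟨|b| / 2 * M, fun κ => ?_⟩
  rw [pair_kernel_identity κ hω a b]
  have hJκ : ‖J κ‖ ≤ M := hM κ (mem_univ κ)
  have hMnn : 0 ≤ M := (norm_nonneg _).trans hJκ
  change ‖((-(b / 2) : ℝ) : ℂ) * (Complex.I * ((sectorPhase ω₂ κ : ℝ) : ℂ) * J κ)‖ ≤ |b| / 2 * M * |sectorPhase ω₂ κ|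
  rw [norm_mul, norm_mul, norm_mul, Complex.norm_real, Complex.norm_real, Complex.norm_I, Real.norm_eq_abs,
    Real.norm_eq_abs, abs_neg, abs_div, abs_two, one_mul]
  calc |b| / 2 * (|sectorPhase ω₂ κ| * ‖J κ‖) ≤ |b| / 2 * (|sectorPhase ω₂ κ| * M) := by
        gcongr
    _ = |b| / 2 * M * |sectorPhase ω₂ κ| := by ring

/-! ## §2 The identities part of the stub, assembled -/

/-- **KΦ, identities part** (`Sig.forceKernelIdentities` of the skeleton): the Wick presentation of `Φ`, the
vanishing of its degree-2 chaos vector, and the bracket-times-vertex structure of its pair kernel.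
[cite: AokiLukkarinenSpohn2006, §3 eqs. (3.3), (3.15)–(3.17)] -/
theorem forceKernelIdentities :
    (∀ ω₂ a b : ℝ, 0 < ω₂ →
    ∃ (J : ℕ) (c : Fin J → ℝ) (f : Fin J → Fin 4 → TestFn) (J' : ℕ) (d : Fin J' → ℝ) (g : Fin J' → Fin 2 → TestFn) (c₀ : ℝ),
      (∀ σ : ChainConfig, (fun σ : ChainConfig => liouvilleZ (pinnedChain ω₂ a b 1) (fun σ => (pinnedChain ω₂ 0 0 1).bondCurrentZ σ 0) σ - liouvilleZ (pinnedChain ω₂ 0 0 1) (fun σ => (pinnedChain ω₂ 0 0 1).bondCurrentZ σ 0) σ + b * (liouvilleZ (pinnedChain ω₂ 0 0 1) (fun σ => (pinnedChain ω₂ 0 1 1).bondCurrentZ σ 0) σ - liouvilleZ (pinnedChain ω₂ 0 0 1) (fun σ => (pinnedChain ω₂ 0 0 1).bondCurrentZ σ 0) σ)) σ =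
          (fun σ : ChainConfig => (∑ j : Fin J, c j * wick ω₂ 1 4 (f j) σ) + (∑ j : Fin J', d j * wick ω₂ 1 2 (g j) σ) + c₀) σ) ∧
      (∑ j : Fin J', (d j : ℂ) • wickVector ω₂ 1 (g j)) = 0 ∧
      (∃ A : ℝ, A ≠ 0 ∧ ∃ C : ℝ, ∀ κ : Shell 2 2,
          ‖(∑ j : Fin J, (c j : ℂ) * wickKernel ω₂ 1 (f j) 2 2 κ) -
              (A : ℂ) * Complex.I *
                ((sinT ((κ : SectorConfig 2 2).1 0) + sinT ((κ : SectorConfig 2 2).1 1) - sinT ((κ : SectorConfig 2 2).2 0) - sinT ((κ : SectorConfig 2 2).2 1) : ℝ) : ℂ) *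
                (PinnedChainKinetic.vertex a b ((κ : SectorConfig 2 2).1 0, (κ : SectorConfig 2 2).1 1, (κ : SectorConfig 2 2).2 0) : ℂ) /
                ((PinnedChainKinetic.dispersion ω₂ ((κ : SectorConfig 2 2).1 0) * PinnedChainKinetic.dispersion ω₂ ((κ : SectorConfig 2 2).1 1) * PinnedChainKinetic.dispersion ω₂ ((κ : SectorConfig 2 2).2 0) * PinnedChainKinetic.dispersion ω₂ ((κ : SectorConfig 2 2).2 1) : ℝ) : ℂ)‖ ≤
            C * |sectorPhase ω₂ κ|)) := by
  intro ω₂ a b hω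
  refine ⟨10, (![a / 2, a / 2, b / 2, -(b / 2), 3 * b / 2, -(3 * b / 2), b * ω₂ / 2, b * ω₂ / 2, -(b / 2), b / 2] : Fin 10 → ℝ), (![![((Finsupp.single 1 1, 0) + (Finsupp.single 0 (-1), 0)), (Finsupp.single 0 1, 0), (Finsupp.single 0 1, 0), (Finsupp.single 0 1, 0)], ![((Finsupp.single 1 1, 0) + (Finsupp.single 0 (-1), 0)), (Finsupp.single 1 1, 0), (Finsupp.single 1 1, 0), (Finsupp.single 1 1, 0)], ![((Finsupp.single 1 1, 0) + (Finsupp.single 0 (-1), 0)), ((Finsupp.single 0 1, 0) + (Finsupp.single (-1) (-1), 0)), ((Finsupp.single 0 1, 0) + (Finsupp.single (-1) (-1), 0)), ((Finsupp.single 0 1, 0) + (Finsupp.single (-1) (-1), 0))], ![((Finsupp.single 1 1, 0) + (Finsupp.single 0 (-1), 0)), ((Finsupp.single 2 1, 0) + (Finsupp.single 1 (-1), 0)), ((Finsupp.single 2 1, 0) + (Finsupp.single 1 (-1), 0)), ((Finsupp.single 2 1, 0) + (Finsupp.single 1 (-1), 0))], ![(0, Finsupp.single 0 1), (0, Finsupp.single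 0 1), ((Finsupp.single 1 1, 0) + (Finsupp.single 0 (-1), 0)), ((Finsupp.single 1 1, 0) + (Finsupp.single 0 (-1), 0))], ![(0, Finsupp.single 1 1), (0, Finsupp.single 1 1), ((Finsupp.single 1 1, 0) + (Finsupp.single 0 (-1), 0)), ((Finsupp.single 1 1, 0) + (Finsupp.single 0 (-1), 0))], ![(Finsupp.single 0 1, 0), ((Finsupp.single 1 1, 0) + (Finsupp.single 0 (-1), 0)), ((Finsupp.single 1 1, 0) + (Finsupp.single 0 (-1), 0)), ((Finsupp.single 1 1, 0) + (Finsupp.single 0 (-1), 0))], ![(Finsupp.single 1 1, 0), ((Finsupp.single 1 1, 0) + (Finsupp.single 0 (-1), 0)), ((Finsupp.single 1 1, 0) + (Finsupp.single 0 (-1), 0)), ((Finsupp.single 1 1, 0) + (Finsupp.single 0 (-1), 0))], ![((Finsupp.single 2 1, 0) + (Finsupp.single 1 (-1), 0)), ((Finsupp.single 1 1, 0) + (Finsupp.single 0 (-1), 0)), ((Finsupp.single 1 1, 0) + (Finsupp.single 0 (-1), 0)), ((Finsupp.single 1 1, 0) + (Finsupp.single 0 (-1), 0))], ![((Finsupp.single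 0 1, 0) + (Finsupp.single (-1) (-1), 0)), ((Finsupp.single 1 1, 0) + (Finsupp.single 0 (-1), 0)), ((Finsupp.single 1 1, 0) + (Finsupp.single 0 (-1), 0)), ((Finsupp.single 1 1, 0) + (Finsupp.single 0 (-1), 0))]] : Fin 10 → Fin 4 → TestFn), 10,
    (![3 * a / 2 * (greenFn ω₂ 1 - greenFn ω₂ 0), -(3 * a / 2 * (greenFn ω₂ 1 - greenFn ω₂ 0)), 3 * a / 2 * greenFn ω₂ 0 + 3 * b * ω₂ / 2 * (2 * greenFn ω₂ 0 - 2 * greenFn ω₂ 1), 3 * a / 2 * greenFn ω₂ 0 + 3 * b * ω₂ / 2 * (2 * greenFn ω₂ 0 - 2 * greenFn ω₂ 1), 3 * b / 2 * (2 * greenFn ω₂ 1 - greenFn ω₂ 0 - greenFn ω₂ 2), -(3 * b / 2 * (2 * greenFn ω₂ 1 - greenFn ω₂ 0 - greenFn ω₂ 2)), 3 * b * (2 * greenFn ω₂ 0 - 2 * greenFn ω₂ 1), -(3 * b * (2 * greenFn ω₂ 0 - 2 * greenFn ω₂ 1)), 3 * b / 2 * (2 * greenFn ω₂ 0 - 2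 * greenFn ω₂ 1), -(3 * b / 2 * (2 * greenFn ω₂ 0 - 2 * greenFn ω₂ 1))] : Fin 10 → ℝ),
    (![![(Finsupp.single 0 1, 0), (Finsupp.single 0 1, 0)], ![(Finsupp.single 1 1, 0), (Finsupp.single 1 1, 0)], ![((Finsupp.single 1 1, 0) + (Finsupp.single 0 (-1), 0)), (Finsupp.single 0 1, 0)], ![((Finsupp.single 1 1, 0) + (Finsupp.single 0 (-1), 0)), (Finsupp.single 1 1, 0)], ![((Finsupp.single 0 1, 0) + (Finsupp.single (-1) (-1), 0)), ((Finsupp.single 0 1, 0) + (Finsupp.single (-1) (-1), 0))], ![((Finsupp.single 2 1, 0) + (Finsupp.single 1 (-1), 0)), ((Finsupp.single 2 1, 0) + (Finsupp.single 1 (-1), 0))], ![((Finsupp.single 1 1, 0) + (Finsupp.single 0 (-1), 0)), ((Finsupp.single 0 1, 0) + (Finsupp.single (-1) (-1), 0))], ![((Finsupp.single 1 1, 0) + (Finsupp.single 0 (-1), 0)), ((Finsupp.single 2 1, 0) + (Finsupp.single 1 (-1), 0))], ![(0, Finsupp.single 0 1), (0, Finsupp.single 0 1)], ![(0, Finsupp.single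 1 1), (0, Finsupp.single 1 1)]] : Fin 10 → Fin 2 → TestFn), 0, fun σ => presentation_identity ω₂ a b σ,
    degree_two_wickVector_eq_zero hω a b, -3 / 4, by norm_num, pair_bound hω a b⟩


end Summit.AtomisticToContinuum.FouriersLaw.Theorems.DrudeDissolution.GramPencilHarmonicChaos

end
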